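import Summits.BirchSwinnertonDyer.BirchSwinnertonDyer.Theorems.KimAtThreeTwoExponentPortOfZetaBodyStable
import Summits.BirchSwinnertonDyer.BirchSwinnertonDyer.Theorems.KimAtThreeOffStratumAdditiveDefectOfFineKato
import HarnessLib

/-!
# Route `KimAtThreeKolyvagin` (rung W2), crux 19679 (`DeepLowerAtThreeOffKatoStratum`): the ADDITIVE SLICE of seat w2-c2
# gen 6's deep-guard port PORT@3-TORS-DEEP-OFF is a THEOREM modulo the fine Kato package (C1₂) + (C1₂ᵗ)
# (cell `bsd-addord`, seat `bsd-addord-w2-acc3` (PROGRAMME PART 1b row (3)), gen 4)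

HONEST FRAMING. TOOL theorem only (no definition, no named fact, no `sorry`); nothing asserted, nothing booked, no mark
moved; crux 19679 stays OPEN (its OWNER assembles).  `--supports` stmt-BirchSwinnertonDyer-19679.

## What and why

Seat w2-c2 gen 6 (the OWNER of 19679) displays, for 19679 / 19075 BY NAME on EVERY row (`KimAtThreeDeepLowerPortDeepTorsionCruxes`,
p487515), ONE port hypothesis PORT@3-TORS-DEEP-OFF (consumer text `HOME/w2c2/PORT-TORS-DEEP-OFF-CONSUMER-g6.txt`): for every
tower row OFF the Kato stratum, every `t`, every torsion-STABLE level `M` of `E(ℚ_{v₃})` (Mazur–Rubin App. A Prop. A.2), every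
`η`, every lattice-optimal `P` at the conductor: `∃ e, ∀ k ≤ k′, ∀ τ-data with DEEP guards (k + M) k / (k′ + M) k′, ∀ pinned
red`: the two-depth `KatoKuriharaWitnessAtTwoExp W₀ · t e · v₃ P` + (COMP); and records its discharger-to-be as «two-depth D6b with
one σ + `isKolyvaginSystem_derivativeFamily_of_transverse_eq` with the local condition at 3 from T-DER-BP + `map_derivativeFamily_eq`
— all ingredients in the tree, not assembled».  THIS SEAT ASSEMBLED EXACTLY THAT in the same hours
(`KimAtThreeDeepLowerKolyvaginPairStable` p484421 → ★★-stable `KimAtThreeTwoExponentWitnessPairStable` p485254).  Hence: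

* `portTorsDeepOff_additive_of_fineKato_of_fineKatoT : (C1₂) → (C1₂ᵗ) → PORT@3-TORS-DEEP-OFF|_{Addv}` — w2-c2's port text
  VERBATIM with ONE antecedent added (`Addv W₀ 3`: the additive slice), from the fine Kato package on the `t = 0` defect rows
  (C1₂) and on the `t ≥ 1` rows (C1₂ᵗ) (this seat's / acc6's binders, verbatim) — the certificate supply being seat w2-c3's
  THEOREM `certSupply_of_addv`, the value rows n1011's `ValueRow.valueRow_of_zetaBody` at torsion exponent `t`, the witness
  pair ★★-stable at `N₀ = M` (the deep guard `(k + M) k` makes the primes Kolyvagin of level `3^{k+M+1}`, exactly the depth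
  the place `3` costs at a row stable at `M`).

NET for the planner: PORT@3-TORS-DEEP-OFF = (additive slice: THEOREM modulo (C1₂)+(C1₂ᵗ), this file) ∧ (non-additive slice:
open, a different object — the Euler factor at a good / multiplicative `3`, definition item `defn-KatoKuriharaDictionaryThreeNonAddAt`).
Together with w2-c2's `deepLowerAtThreeOffKatoStratum_of_sak_of_portDeepOff` this is a SECOND kernel road (besides this seat's
port-free `KimAtThreeOffStratumTorsionRowsOfFineKatoPinned`) putting the additive rows of 19679 on PUB + the fine Kato package.
Credit: w2-c2 gen 6 (port text, cruxes by name), acc6 (two-exponent chain), w2-c3 (D-u, StableThree, cert supply), team n1011.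
References: [MazurRubin2004] App. A Prop. A.2 (pp. 79–80), Thm. 3.2.4, Remark A.5; [Kim2022StructureSelmer] Thm. 3.13, §3.1–§3.3;
[Kato2004Asterisque] (8.1.3), §9.4, Thm. 9.7, Thm. 6.6 (1), Ex. 13.3; [Sakamoto2024] §2, Def. 4.1; [Kim2025RefinedTNC] §4.2, §8.1.2;
[TateGCFT1967] §2.4.
-/

set_option autoImplicit false
-- the Theorems namespace of a single-conjunct summit repeats the summit name by design (D-0017)
set_option linter.dupNamespace false

noncomputable section

open scoped NumberField TensorProduct ContRepresentation Classical
open Field Finset IsDedekindDomain NumberField WeierstrassCurve Rat.HeightOneSpectrum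
open Literature.NumberTheory.GaloisRepresentations Literature.NumberTheory.GaloisCohomology
open Literature.NumberTheory.GaloisRepresentations.DiscreteGaloisModule
open Literature.NumberTheory.EllipticCurves Literature.NumberTheory.EllipticCurves.ModularForms
open Literature.NumberTheory.EllipticCurves.Rank1Residual
open Literature.NumberTheory.EllipticCurves.Kato2004
open Literature.NumberTheory.EllipticCurves.Kato2004.EulerSystemValues
open Summit.BirchSwinnertonDyer.Rank1Residual.GaloisImage
open Summit.BirchSwinnertonDyer.BirchSwinnertonDyer.Theorems
open Summit.BirchSwinnertonDyer.BirchSwinnertonDyer.Theorems.KimAtThreeKolyvaginDefs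
open Summit.BirchSwinnertonDyer.BirchSwinnertonDyer.Theorems.KimAtThreeKolyvaginPortShared
open Summit.BirchSwinnertonDyer.BirchSwinnertonDyer.Theorems.KimAtThreeDeepUpperCertSupplyDefect

namespace Summit.BirchSwinnertonDyer.BirchSwinnertonDyer.Theorems.KimAtThreePortTorsDeepAdditiveOfFineKato

/-- Local notation: the TWO-EXPONENT rider clause (ii₂) at depth `j`, torsion exponent `t`, defect exponent
`e`, place `v`, for the pair `(Λ, Λf)` (n1011's `KatoExpStarFiniteLevelAt` clause (ii), conclusion `× 3^e`). -/
local notation3 (prettyPrint := false) "RIDER₂⟦" W' ", " j ", " t' ", " e' ", " v' ", " Λ' ", " Λf "⟧" =>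
  ∀ (r : Finset (HeightOneSpectrum (𝓞 ℚ)))
    (Ψ : H1 (tateRep W' 3) (cycSubgroup 3 0 r) →+
      continuousCohomology 1
        (subgroupRep (WeierstrassCurve.torsionGaloisModule W' (((3 : ℕ) : ℤ) ^ j * ((3 : ℕ) : ℤ))).toTopRep
          (cycSubgroup 3 0 r))),
    (∀ (φ : contOneCocycles (subgroupRep (tateRep W' 3).toTopRep (cycSubgroup 3 0 r)))
        (ψ : contOneCocycles
          (subgroupRep (WeierstrassCurve.torsionGaloisModule W' (((3 : ℕ) : ℤ) ^ j * ((3 : ℕ) : ℤ))).toTopRep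
            (cycSubgroup 3 0 r))),
        (∀ g, ((ψ.1 g : geomTorsion W' (((3 : ℕ) : ℤ) ^ j * ((3 : ℕ) : ℤ))) : geomPoints W') =
          TateModule.proj 3 (j + 1) (φ.1 g)) →
        Ψ (oneCocycleClass _ φ) = oneCocycleClass _ ψ) →
    ∀ (y : H1 (tateRep W' 3) (cycSubgroup 3 0 r))
      (κ₀ : galoisCohomology (WeierstrassCurve.torsionGaloisModule W' (((3 : ℕ) : ℤ) ^ j * ((3 : ℕ) : ℤ))) 1)
      (s : ℤ_[3]),
      resSubgroup (WeierstrassCurve.torsionGaloisModule W' (((3 : ℕ) : ℤ) ^ j * ((3 : ℕ) : ℤ))).toTopRep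
          (cycSubgroup 3 0 r) 1 κ₀ = Ψ y →
      galoisCohomology.localization (WeierstrassCurve.torsionGaloisModule W' (((3 : ℕ) : ℤ) ^ j * ((3 : ℕ) : ℤ)))
          (Sum.inr v') 1 κ₀ ∈ propagatedSelmerStructure W' 3 j (Sum.inr v') →
      (∃ l ∈ cycIntLattice 3 (cycLevel 3 0 r),
          (((3 : ℕ) : ℤ_[3]) ^ t') • Λ' 0 r y - ((s : ℚ_[3]) ⊗ₜ[ℚ] (1 : CyclotomicField (cycLevel 3 0 r) ℚ)) =
            (((3 : ℕ) : ℤ_[3]) ^ (j + 1)) • (l : ℚ_[3] ⊗[ℚ] CyclotomicField (cycLevel 3 0 r) ℚ)) →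
      ((3 ^ e' : ℕ) : ZMod (3 ^ (j + 1))) *
        Λf (galoisCohomology.localization
          (WeierstrassCurve.torsionGaloisModule W' (((3 : ℕ) : ℤ) ^ j * ((3 : ℕ) : ℤ))) (Sum.inr v') 1 κ₀) =
        PadicInt.toZModPow (j + 1) s

/-- Local notation: **(C1₂) the FINE KATO PACKAGE in two-exponent form** on the additive-defect rows. -/
local notation3 (prettyPrint := false) "FINEKATO₂" =>
  ∀ (W : WeierstrassCurve ℚ) [W.IsElliptic] [W.IsGloballyMinimal]
    [ContinuousSMul ℤ_[3] (W.tateModule 3)] [Module.Free ℤ_[3] (W.tateModule 3)]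
    [Module.Finite ℤ_[3] (W.tateModule 3)],
    (∀ m : ℕ, W.HasSurjectiveModNGaloisRep (3 ^ m : ℕ)) →
    (haveI : Fact (Nat.Prime 3) := ⟨Nat.prime_three⟩; Addv W 3) →
    Nat.card {Q : (W.baseChange ℚ_[3]).toAffine.Point // (3 : ℕ) • Q = 0} = 1 →
    ∀ (v₃ : HeightOneSpectrum (𝓞 ℚ)), ((3 : ℕ) : 𝓞 ℚ) ∈ v₃.asIdeal →
    ∀ {N : ℕ} [NeZero N] (P : ModularParametrizationData W N), N = W.conductorNorm ℤ →
      (∀ z ∈ P.L.lattice, ∃ w ∈ periodLattice P.f, z = P.c * w) →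
      (3 ∣ (W.baseChange ℚ_[3]).localTamagawaNumber ℤ_[3] ∨ (3 : ℤ) ∣ P.maninConstant) →
      ∃ (ι : (n : ℕ) → (CyclotomicField n ℚ →+* ℂ)) (κK : ℝ)
        (Λ : ∀ (k' : ℕ) (r : Finset (HeightOneSpectrum (𝓞 ℚ))),
          H1 (tateRep W 3) (cycSubgroup 3 k' r) →ₗ[ℤ_[3]]
            ℚ_[3] ⊗[ℚ] CyclotomicField (cycLevel 3 k' r) ℚ)
        (Λfin : ∀ j : ℕ, galoisCohomology
          ((W.torsionGaloisModule (((3 : ℕ) : ℤ) ^ j * ((3 : ℕ) : ℤ))).toLocal (Sum.inr v₃)) 1 →+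
            ZMod (3 ^ (j + 1))) (e : ℕ),
        κK ≠ 0 ∧ (∃ u : ℚ, (u : ℝ) = κK ∧ padicValRat 3 u = 0) ∧
        (∀ j : ℕ,
          (∀ c : ZMod (3 ^ (j + 1)), ∃ x ∈ propagatedSelmerStructure W 3 j (Sum.inr v₃), Λfin j x = c) ∧
          (∀ x ∈ propagatedSelmerStructure W 3 j (Sum.inr v₃),
            Λfin j x = 0 ↔ x ∈ W.kummerSelmerStructure (((3 : ℕ) : ℤ) ^ j * ((3 : ℕ) : ℤ)) (Sum.inr v₃))) ∧
        (∀ j : ℕ, RIDER₂⟦W, j, 0, e, v₃, Λ, Λfin j⟧) ∧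
        ∀ (c d a : ℤ) (A : ℕ), 0 < A → Int.gcd c (6 * 3 * A) = 1 → Int.gcd d (6 * 3 * N) = 1 →
          ∃ (z : ∀ (k' : ℕ) (r : (cyclotomicLevelsRat 3 (badPlaces c d A N)).Ideals),
                H1 (tateRep W 3) ((cyclotomicLevelsRat 3 (badPlaces c d A N)).level k' r.1))
            (x : ∀ (k' : ℕ) (r : (cyclotomicLevelsRat 3 (badPlaces c d A N)).Ideals),
                CyclotomicField (cycLevel 3 k' r.1) ℚ),
            ZetaBody W 3 P.f ι κK Λ c d a A z x

/-- Local notation: **(C1₂ᵗ) the FINE KATO PACKAGE in two-exponent form on the additive rows with `#E(ℚ₃)[3] = 3^t`,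
`1 ≤ t`** — (C1₂) with the row binders `#E(ℚ₃)[3] = 1`, `3 ∣ c₃ ∨ 3 ∣ c_P` replaced by `1 ≤ t`, `#E(ℚ₃)[3] = 3^t`, and
the rider clause (ii₂) read at torsion exponent `t` (the SAME object: SOME Kato witnesses of the `ZetaBody` family with
finite-level functionals, (Λ)-clauses and two-exponent riders for ONE `e`; CONSTRUCTION-SHAPED, never `_holds`). -/
local notation3 (prettyPrint := false) "FINEKATOᵀ" =>
  ∀ (W : WeierstrassCurve ℚ) [W.IsElliptic] [W.IsGloballyMinimal]
    [ContinuousSMul ℤ_[3] (W.tateModule 3)] [Module.Free ℤ_[3] (W.tateModule 3)]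
    [Module.Finite ℤ_[3] (W.tateModule 3)],
    (∀ m : ℕ, W.HasSurjectiveModNGaloisRep (3 ^ m : ℕ)) →
    (haveI : Fact (Nat.Prime 3) := ⟨Nat.prime_three⟩; Addv W 3) →
    ∀ (t : ℕ), 1 ≤ t → Nat.card {Q : (W.baseChange ℚ_[3]).toAffine.Point // (3 : ℕ) • Q = 0} = 3 ^ t →
    ∀ (v₃ : HeightOneSpectrum (𝓞 ℚ)), ((3 : ℕ) : 𝓞 ℚ) ∈ v₃.asIdeal →
    ∀ {N : ℕ} [NeZero N] (P : ModularParametrizationData W N), N = W.conductorNorm ℤ →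
      (∀ z ∈ P.L.lattice, ∃ w ∈ periodLattice P.f, z = P.c * w) →
      ∃ (ι : (n : ℕ) → (CyclotomicField n ℚ →+* ℂ)) (κK : ℝ)
        (Λ : ∀ (k' : ℕ) (r : Finset (HeightOneSpectrum (𝓞 ℚ))),
          H1 (tateRep W 3) (cycSubgroup 3 k' r) →ₗ[ℤ_[3]]
            ℚ_[3] ⊗[ℚ] CyclotomicField (cycLevel 3 k' r) ℚ)
        (Λfin : ∀ j : ℕ, galoisCohomology
          ((W.torsionGaloisModule (((3 : ℕ) : ℤ) ^ j * ((3 : ℕ) : ℤ))).toLocal (Sum.inr v₃)) 1 →+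
            ZMod (3 ^ (j + 1))) (e : ℕ),
        κK ≠ 0 ∧ (∃ u : ℚ, (u : ℝ) = κK ∧ padicValRat 3 u = 0) ∧
        (∀ j : ℕ,
          (∀ c : ZMod (3 ^ (j + 1)), ∃ x ∈ propagatedSelmerStructure W 3 j (Sum.inr v₃), Λfin j x = c) ∧
          (∀ x ∈ propagatedSelmerStructure W 3 j (Sum.inr v₃),
            Λfin j x = 0 ↔ x ∈ W.kummerSelmerStructure (((3 : ℕ) : ℤ) ^ j * ((3 : ℕ) : ℤ)) (Sum.inr v₃))) ∧
        (∀ j : ℕ, RIDER₂⟦W, j, t, e, v₃, Λ, Λfin j⟧) ∧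
        ∀ (c d a : ℤ) (A : ℕ), 0 < A → Int.gcd c (6 * 3 * A) = 1 → Int.gcd d (6 * 3 * N) = 1 →
          ∃ (z : ∀ (k' : ℕ) (r : (cyclotomicLevelsRat 3 (badPlaces c d A N)).Ideals),
                H1 (tateRep W 3) ((cyclotomicLevelsRat 3 (badPlaces c d A N)).level k' r.1))
            (x : ∀ (k' : ℕ) (r : (cyclotomicLevelsRat 3 (badPlaces c d A N)).Ideals),
                CyclotomicField (cycLevel 3 k' r.1) ℚ),
            ZetaBody W 3 P.f ι κK Λ c d a A z x

/-- Local notation: **PORT@3-TORS-DEEP-OFF restricted to the ADDITIVE rows** — seat w2-c2 gen 6's consumer text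
`HOME/w2c2/PORT-TORS-DEEP-OFF-CONSUMER-g6.txt` VERBATIM with the single antecedent `Addv W₀ 3` inserted after the tower binder. -/
local notation3 (prettyPrint := false) "PORTTORSDEEPOFF_ADD" =>
  ∀ (W₀ : WeierstrassCurve ℚ) [W₀.IsElliptic] [W₀.IsGloballyMinimal],
      (∀ n : ℕ, W₀.HasSurjectiveModNGaloisRep (3 ^ n : ℕ)) →
      (haveI : Fact (Nat.Prime 3) := ⟨Nat.prime_three⟩; Addv W₀ 3) →
      ∀ (t M : ℕ), Nat.card {Q : (W₀.baseChange ℚ_[3]).toAffine.Point // (3 : ℕ) • Q = 0} = 3 ^ t →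
      ∀ (v₃ : HeightOneSpectrum (𝓞 ℚ)), ((3 : ℕ) : 𝓞 ℚ) ∈ v₃.asIdeal →
      (∀ Q : (W₀.baseChange (v₃.adicCompletion ℚ)).toAffine.Point, 3 ^ (M + 1) • Q = 0 → 3 ^ M • Q = 0) →
      ∀ (η : (q : HeightOneSpectrum (𝓞 ℚ)) → (ZMod (Ideal.absNorm q.asIdeal))ˣ),
        (∀ q, Subgroup.zpowers (η q) = ⊤) →
      ∀ {N : ℕ} [NeZero N] (P : ModularParametrizationData W₀ N), N = W₀.conductorNorm ℤ →
        (∀ z ∈ P.L.lattice, ∃ w ∈ periodLattice P.f, z = P.c * w) →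
        ¬ ((haveI : Fact (Nat.Prime 3) := ⟨Nat.prime_three⟩; Addv W₀ 3) ∧
            ¬ 3 ∣ (W₀.baseChange ℚ_[3]).localTamagawaNumber ℤ_[3] ∧
            Nat.card {Q : (W₀.baseChange ℚ_[3]).toAffine.Point // (3 : ℕ) • Q = 0} = 1 ∧
            ¬ (3 : ℤ) ∣ P.maninConstant) →
        ∃ e : ℕ, ∀ (k k' : ℕ)
          (Dk : KolyvaginDatum (W₀.torsionGaloisModule (((3 : ℕ) : ℤ) ^ k * ((3 : ℕ) : ℤ))))
          (Dk' : KolyvaginDatum (W₀.torsionGaloisModule (((3 : ℕ) : ℤ) ^ k' * ((3 : ℕ) : ℤ))))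
          (red : (W₀.torsionGaloisModule (((3 : ℕ) : ℤ) ^ k' * ((3 : ℕ) : ℤ))).toContRepresentation →ⁱL
            (W₀.torsionGaloisModule (((3 : ℕ) : ℤ) ^ k * ((3 : ℕ) : ℤ))).toContRepresentation),
          Dk.IsCanonicalTauDatumThreeAtWith W₀ (k + M) k η → Dk'.IsCanonicalTauDatumThreeAtWith W₀ (k' + M) k' η →
          k ≤ k' →
          (∀ x : geomTorsion W₀ (((3 : ℕ) : ℤ) ^ k' * ((3 : ℕ) : ℤ)),
            ((red x : geomTorsion W₀ (((3 : ℕ) : ℤ) ^ k * ((3 : ℕ) : ℤ))) : geomPoints W₀) =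
              (((3 : ℕ) : ℤ) ^ (k' - k)) • (x : geomPoints W₀)) →
          ∃ κ Λ κ' κu Λu κu',
            KatoKuriharaWitnessAtTwoExp W₀ k t e Dk v₃ P κ Λ κ' ∧
            KatoKuriharaWitnessAtTwoExp W₀ k' t e Dk' v₃ P κu Λu κu' ∧
            ∀ d, Dk'.IsLevel d → Dk.IsLevel d →
              galoisCohomology.map red 1 (κu d) = κ d ∧ galoisCohomology.map red 1 (κu' d) = κ' d

set_option backward.isDefEq.respectTransparency false in
/-- **The additive slice of PORT@3-TORS-DEEP-OFF ⟸ the fine Kato package (C1₂) + (C1₂ᵗ).**  At an additive off-stratum tower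
row with `#E(ℚ₃)[3] = 3^t`, `E(ℚ_{v₃})` torsion-stable at `M`, generators `η`, a lattice-optimal `P` at the conductor: the row is a
`t = 0` DEFECT row (off-stratum ∧ additive ∧ `t = 0` ⇒ `3 ∣ c₃ ∨ 3 ∣ c_P`) served by (C1₂), or a `t ≥ 1` row served by (C1₂ᵗ);
Kato's auxiliary cusp datum comes from w2-c3's `certSupply_of_addv`; the exponent `e` is the package's; and for every pair of
τ-data with deep guards `(k + M) k` / `(k′ + M) k′` (whence Kolyvagin primes of level `3^{k+M+1}` / `3^{k′+M+1}`, E1-deep) the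
two-depth witnesses + (COMP) are ★★-stable (`exists_katoKuriharaWitnessAtTwoExp_pair_of_zetaBody_of_stable_of_unramified`) at
`N₀ = M`, with the value rows of `ValueRow.valueRow_of_zetaBody` at torsion exponent `t` (the stability binder moves from `v₃` to
the unique place over `3` by injectivity of `primesEquiv`).  Displayed: (C1₂), (C1₂ᵗ); nothing booked.
[cite: MazurRubin2004, App. A Prop. A.2 (pp. 79–80), Thm. 3.2.4 and Remark A.5] [cite: Kim2022StructureSelmer, Thm. 3.13 and §3.1–§3.3]
[cite: Kato2004Asterisque, (8.1.3) (p. 180), §9.4 (p. 188), Thm. 9.7 (p. 189), Thm. 6.6 (1) (p. 163), Ex. 13.3 (pp. 224–225)]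
[cite: Sakamoto2024, §2 and Def. 4.1] [cite: Kim2025RefinedTNC, §4.2 and §8.1.2] [cite: TateGCFT1967, §2.4] -/
theorem portTorsDeepOff_additive_of_fineKato_of_fineKatoT (hC1 : FINEKATO₂) (hC1t : FINEKATOᵀ) :
    PORTTORSDEEPOFF_ADD := by
  intro W₀ _ _ htow hA t M ht v₃ hv₃ hstab η hη N _ P hN hlat hoff
  haveI : Fact (Nat.Prime 3) := ⟨Nat.prime_three⟩
  haveI : ContinuousSMul ℤ_[3] (W₀.tateModule 3) := TateModule.continuousSMul_padicInt
  haveI : Module.Free ℤ_[3] (W₀.tateModule 3) := W₀.module_free_tateModule_holds 3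
  haveI : Module.Finite ℤ_[3] (W₀.tateModule 3) := W₀.module_finite_tateModule_holds 3
  have hirr : W₀.HasIrreducibleModPGaloisRep 3 := hasIrreducibleModPGaloisRep_three_of_tower W₀ htow
  have hpN : 3 ^ 2 ∣ N := hN ▸ sq_dvd_conductorNorm_of_addv W₀ hA
  have hv₃3 : ((primesEquiv v₃ : Nat.Primes) : ℕ) = 3 := primesEquiv_eq_of_natCast_mem Nat.prime_three hv₃
  -- the stability binder at every place over `3` (there is only `v₃`)
  have hstab' : ∀ w : HeightOneSpectrum (𝓞 ℚ), ((primesEquiv w : Nat.Primes) : ℕ) = 3 →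
      ∀ Q : (W₀.baseChange (w.adicCompletion ℚ)).toAffine.Point, 3 ^ (M + 1) • Q = 0 → 3 ^ M • Q = 0 := by
    intro w hw
    have hwv : w = v₃ := (primesEquiv (R := 𝓞 ℚ)).injective (Subtype.ext (hw.trans hv₃3.symm))
    subst hwv
    exact hstab
  -- Kato's auxiliary cusp datum with unit value certificates (w2-c3's THEOREM)
  obtain ⟨c, d, a, A, d', aM, hA0, hcA, hdN, hcdA, hcd, hdd', hAN, haM, hE0, hE, hR0, hR⟩ :=
    certSupply_of_addv W₀ (by simpa using htow 1) hA P hN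
  haveI : NeZero A := ⟨hA0.ne'⟩
  -- the fine Kato package at torsion exponent `t`: (C1₂) on the `t = 0` defect rows, (C1₂ᵗ) on the `t ≥ 1` rows
  obtain ⟨ι, κK, Λ, Λfin, e, hκ0, hNorm, hΛ, hfin₂, hz⟩ :
      ∃ (ι : (n : ℕ) → (CyclotomicField n ℚ →+* ℂ)) (κK : ℝ)
        (Λ : ∀ (k' : ℕ) (r : Finset (HeightOneSpectrum (𝓞 ℚ))),
          H1 (tateRep W₀ 3) (cycSubgroup 3 k' r) →ₗ[ℤ_[3]]
            ℚ_[3] ⊗[ℚ] CyclotomicField (cycLevel 3 k' r) ℚ)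
        (Λfin : ∀ j : ℕ, galoisCohomology
          ((W₀.torsionGaloisModule (((3 : ℕ) : ℤ) ^ j * ((3 : ℕ) : ℤ))).toLocal (Sum.inr v₃)) 1 →+
            ZMod (3 ^ (j + 1))) (e : ℕ),
        κK ≠ 0 ∧ (∃ u : ℚ, (u : ℝ) = κK ∧ padicValRat 3 u = 0) ∧
        (∀ j : ℕ,
          (∀ c : ZMod (3 ^ (j + 1)), ∃ x ∈ propagatedSelmerStructure W₀ 3 j (Sum.inr v₃), Λfin j x = c) ∧
          (∀ x ∈ propagatedSelmerStructure W₀ 3 j (Sum.inr v₃),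
            Λfin j x = 0 ↔ x ∈ W₀.kummerSelmerStructure (((3 : ℕ) : ℤ) ^ j * ((3 : ℕ) : ℤ)) (Sum.inr v₃))) ∧
        (∀ j : ℕ, RIDER₂⟦W₀, j, t, e, v₃, Λ, Λfin j⟧) ∧
        ∀ (c d a : ℤ) (A : ℕ), 0 < A → Int.gcd c (6 * 3 * A) = 1 → Int.gcd d (6 * 3 * N) = 1 →
          ∃ (z : ∀ (k' : ℕ) (r : (cyclotomicLevelsRat 3 (badPlaces c d A N)).Ideals),
                H1 (tateRep W₀ 3) ((cyclotomicLevelsRat 3 (badPlaces c d A N)).level k' r.1))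
            (x : ∀ (k' : ℕ) (r : (cyclotomicLevelsRat 3 (badPlaces c d A N)).Ideals),
                CyclotomicField (cycLevel 3 k' r.1) ℚ),
            ZetaBody W₀ 3 P.f ι κK Λ c d a A z x := by
    rcases Nat.eq_zero_or_pos t with h0 | hpos
    · subst h0
      have ht1 : Nat.card {Q : (W₀.baseChange ℚ_[3]).toAffine.Point // (3 : ℕ) • Q = 0} = 1 := by
        rw [ht, pow_zero]
      have hdef : 3 ∣ (W₀.baseChange ℚ_[3]).localTamagawaNumber ℤ_[3] ∨ (3 : ℤ) ∣ P.maninConstant := by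
        by_contra hcon
        push Not at hcon
        exact hoff ⟨hA, hcon.1, ht1, hcon.2⟩
      exact hC1 W₀ htow hA ht1 v₃ hv₃ P hN hlat hdef
    · exact hC1t W₀ htow hA t hpos ht v₃ hv₃ P hN hlat
  obtain ⟨z, x, hbody⟩ := hz c d a A hA0 hcA hdN
  refine ⟨e, fun k k' Dk Dk' red hDk hDk' hkk' hred => ?_⟩
  -- the guards: transverse, canonical comparison, deep classes ⇒ Kolyvagin primes of level `k + M + 1` / `k′ + M + 1`
  obtain ⟨hT, hC, S, τ, hS, hτμ, hτq, hP⟩ := hDk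
  obtain ⟨hT', hC', S', τ', hS', hτμ', hτq', hP'⟩ := hDk'
  have hKol : ∀ q ∈ Dk.primes, Kato.IsKolyvaginPrime W₀ 3 (k + M + 1) ((primesEquiv q : Nat.Primes) : ℕ) :=
    fun q hq => KolyvaginPrime.isKolyvaginPrime_of_mem_frobeniusClassPrimes_of_le W₀
      (le_refl (k + M)) (fun v hv => (hS v hv).1) hτμ hτq (hP hq)
  have hKol' : ∀ q ∈ Dk'.primes, Kato.IsKolyvaginPrime W₀ 3 (k' + M + 1) ((primesEquiv q : Nat.Primes) : ℕ) :=
    fun q hq => KolyvaginPrime.isKolyvaginPrime_of_mem_frobeniusClassPrimes_of_le W₀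
      (le_refl (k' + M)) (fun v hv => (hS' v hv).1) hτμ' hτq' (hP' hq)
  -- every Kolyvagin prime is a usable prime of Kato's system for `(c, d, A, N)`
  have husable : ∀ (j : ℕ) (q : HeightOneSpectrum (𝓞 ℚ)),
      Kato.IsKolyvaginPrime W₀ 3 (j + 1) ((primesEquiv q : Nat.Primes) : ℕ) →
        q ∈ (cyclotomicLevelsRat 3 (badPlaces c d A N)).primes := by
    intro j q hq
    have hℓ := hq.prime
    have h13 : ((primesEquiv q : Nat.Primes) : ℕ) ≡ 1 [MOD 3] :=
      hq.modEq_one.of_dvd (dvd_pow_self 3 (Nat.succ_ne_zero j))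
    refine (mem_primes_cyclotomicLevelsRat_badPlaces_iff 3 c d A N q).2 ⟨fun hdvd => ?_, hq.ne⟩
    rcases (Nat.Prime.dvd_mul hℓ).mp hdvd with h | h
    · exact hcdA _ hℓ h13 h
    · apply hq.not_dvd
      rw [← hN]
      exact dvd_mul_of_dvd_left h 3
  have hPr : Dk.primes ⊆ (cyclotomicLevelsRat 3 (badPlaces c d A N)).primes :=
    fun q hq => husable (k + M) q (hKol q hq)
  have hPr' : Dk'.primes ⊆ (cyclotomicLevelsRat 3 (badPlaces c d A N)).primes :=
    fun q hq => husable (k' + M) q (hKol' q hq)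
  -- ★★-stable at `N₀ = M`, value rows at torsion exponent `t`
  obtain ⟨κf, κu, h₁, h₂, h₃⟩ :=
    KimAtThreeTwoExponentWitnessPairStable.exists_katoKuriharaWitnessAtTwoExp_pair_of_zetaBody_of_stable_of_unramified
      W₀ P hbody hirr hkk' red hred hv₃ (hΛ k) (hΛ k') (hfin₂ k) (hfin₂ k') Dk hT Dk' hT' hC hC' hPr hPr'
      hstab' hKol hKol'
      (fun σ hI hχ r hr => ValueRow.valueRow_of_zetaBody hbody P.isNewformOf (by decide) hirr hNorm hκ0 d' hcd hdd'
        hAN hpN aM haM hE0 hE hR0 hR η k t σ hI hχ r (fun q hq => hPr (hr (Finset.mem_coe.2 hq)))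
        (fun q hq => (hKol q (hr (Finset.mem_coe.2 hq))).mono (by omega))
        (fun q hq => hC.zpowers_eq_top (hr (Finset.mem_coe.2 hq))))
      (fun σ hI hχ r hr => ValueRow.valueRow_of_zetaBody hbody P.isNewformOf (by decide) hirr hNorm hκ0 d' hcd hdd'
        hAN hpN aM haM hE0 hE hR0 hR η k' t σ hI hχ r (fun q hq => hPr' (hr (Finset.mem_coe.2 hq)))
        (fun q hq => (hKol' q (hr (Finset.mem_coe.2 hq))).mono (by omega))
        (fun q hq => hC'.zpowers_eq_top (hr (Finset.mem_coe.2 hq))))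
  exact ⟨κf, Λfin k, κf, κu, Λfin k', κu, h₁, h₂, fun l hl' hl => ⟨h₃ l hl' hl, h₃ l hl' hl⟩⟩

end Summit.BirchSwinnertonDyer.BirchSwinnertonDyer.Theorems.KimAtThreePortTorsDeepAdditiveOfFineKato

end
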